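/-
Width seat `ym-line-cbag-p1-w3` (prover-ym-line-cbag-p1-w3-g8-0), the only seat on LINE 3 `route-QuantumFields-SixPlaneColdBox`: the TARGET
`BulkDominatesBoxDensityG` (stmt-QuantumFields-25707) and the node `Theorems.LatticeNonFreezing`, now that both cruxes of the route are proved.
-/
import Summits.QuantumFields.YangMills.Theorems.SixPlaneColdBoxTorusMeanNearTopBox
import Summits.QuantumFields.YangMills.Theorems.SixPlaneColdBoxDensityTransferG
import Summits.QuantumFields.YangMills.Theorems.SixPlaneColdBoxAssembly

/-!
# Route `SixPlaneColdBox`: the target `BulkDominatesBoxDensityG` and the node `LatticeNonFreezing`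

LINE 3 of the ideator cell ym-idea-2, complete: crux `TorusMeanNearColdBoxG` (`torusMeanNearColdBoxG_proof`: Chatterjee's free-energy asymptotics
with a power rate `FreeEnergyRate` + Griffiths' lemma + the cold-box comparison), crux `DensityTransferG` (`densityTransferG_proof`: the six-plane
DLR transfer with slack + slack absorption), assembly `assembly_proof` (p1: box floor for the density + polynomial-floor-to-node).  Hence:

* `bulkDominatesBoxDensityG_proof : Theses.SixPlaneColdBox.BulkDominatesBoxDensityG` (item stmt-QuantumFields-25707);
* `latticeNonFreezing_proof : Theorems.LatticeNonFreezing` — for every compact simple `G` and faithful unitary lattice representation, no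
  `(C, μ > 0)` clusters the plaquette field `tr F²` at all large `β` on all large tori (Chatterjee 2019, Problem 5.1, second half, volume-uniform
  form; the `@[conjecture]` node of `Theorems/SoloInformedNonFreezing.lean`).

HONEST LABEL: this is NON-FREEZING (the lattice correlation length of `tr F²` is unbounded as `β → ∞`), a RECORD-type statement; it is NOT
exponential clustering, NOT a continuum limit, and NOT the Yang–Mills mass gap, which is NOT proved by anything here.
-/

set_option autoImplicit false

noncomputable section

namespace Summit.QuantumFields.YangMills.Theorems.SixPlaneColdBox

/-- **The target `BulkDominatesBoxDensityG` of route `SixPlaneColdBox` (stmt-QuantumFields-25707)**: the one-sided DLR transfer of the cold-box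
six-plane covariance floor to the torus — `densityTransferG_proof torusMeanNearColdBoxG_proof`. -/
theorem bulkDominatesBoxDensityG_proof : Summit.QuantumFields.YangMills.Theses.SixPlaneColdBox.BulkDominatesBoxDensityG :=
  densityTransferG_proof torusMeanNearColdBoxG_proof

/-- **Lattice non-freezing** (`Theorems.LatticeNonFreezing`, Chatterjee 2019 Problem 5.1 second half, volume-uniform form): for every compact
simple `G`, faithful unitary lattice representation `r`, constant `C` and rate `μ > 0`, for all large `β` and all large odd tori some
time-translate (and spatial translate) of the curvature density `tr F²` has truncated two-point function `> C e^{−μ n}` — the plaquette field does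
not cluster at any fixed exponential rate uniformly in `β`.  Route `SixPlaneColdBox`: `assembly_proof bulkDominatesBoxDensityG_proof`. -/
theorem latticeNonFreezing_proof : Summit.QuantumFields.YangMills.Theorems.LatticeNonFreezing :=
  assembly_proof bulkDominatesBoxDensityG_proof

end Summit.QuantumFields.YangMills.Theorems.SixPlaneColdBox

end
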